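import Summits.QuantumFields.YangMills.Theorems.PoincareLipschitzMinimiserSecondVariationDirection
import HarnessLib

/-!
# Crux `BlockLipschitzL` (stmt-QuantumFields-23533) ∕ `HistoryTailL` (stmt-QuantumFields-19936), LINE 25 «CompactnessTransfer»,
# K2 continuum face, row (RS) `MinimisingMapSmoothness` — FILE (RS-a)-3 «THE STABILITY INEQUALITY OF BALL MINIMISERS INTO A SPHERE»

Cell `ym3-torus` (YM ladder rung R3 = continuum SU(2) Yang–Mills on T³ — a RUNG, NOT the Clay problem: not d = 4, not infinite
volume, not a mass gap); WIDTH helper seat `ym-ust-19936-w7` g14 (LEAD ★w1-19936 g10 2026-08-29T14:39:36Z «(RS-a) at own risk,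
helper class, keep it limit-free»).  THEOREMS ONLY (0 `def`, 0 `sorry`, default heartbeats); imports FILE (RS-a)-2
✓`PoincareLipschitzMinimiserSecondVariationDirection` (the one-direction inequality ★★★`secondVariation_direction` and the
integrability letters), through it FILE (RS-a)-1 ✓`…MinimiserSecondVariation` (tangency, the normalised competitor) and the
letters ✓`…MinimiserStabilityLetters` (orthonormal-basis sums ✓`sum_q₂_eq`).

THE THEOREM.  `U` weakly differentiable on the open `Ω ⊆ ℝ³` with weak gradient `G`, UNIT on `Ω` with values in a real Hilbert
space `F` of finite dimension `n` (for the vended facts `F = ℝ⁴`, `n = 4`), of finite energy, minimising on the ball `B_ρ(y) ⊆ Ω`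
among finite-energy unit `W^{1,2}(Ω)` competitors agreeing with `U` off some `B_{ρ″}(y)`, `ρ″ < ρ` (w2 g13's `hmin` row VERBATIM
= the minimality clause of lit `MinimisingMapSmoothness` ∕ `…Compactness`).  Then for every `ζ ∈ C^∞` with
`tsupport ζ ⊆ B_{ρ′}(y)`, `ρ′ < ρ`:
`(n − 3) · ∫_{B_ρ(y)} ζ² · Σᵢ‖G eᵢ‖²  ≤  (n − 1) · ∫_{B_ρ(y)} Σᵢ (∂ᵢζ)²`   (★★★ `stability`),
i.e. `(k − 2)∫ζ²|∇U|² ≤ k∫|∇ζ|²` for `S^k`-valued minimisers — [SchoenUhlenbeck1984, (1.3)–(1.5)], the second input (with Hardy's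
inequality and the `8π` energy gap) of their Proposition 1.2 «minimising tangent maps `ℝ³ → S³` are constant», `d(3) = 3`.
§2 gives the `ℝ⁴`-valued case on the unit cube in the letters of the vended facts: `∫ζ²·dens G ≤ 3·∫|∇ζ|²` (★★★ `stability_of_cubeMinimiser`).

PROOF WITHOUT LIMITS.  FILE (RS-a)-2's ★★★`secondVariation_direction`: for a unit `e`, `|ζ| ≤ 1`, `‖∇ζ‖ ≤ 1`, `|t| ≤ ¼`,
minimality against `N(U + tζe)` and the pointwise bound ✓`density_le_expansion` give `0 ≤ t·∫Q₁(e) + t²·∫Q₂(e) + |t|³·S·∫(dens G + |∇ζ|²)`;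
§1 sums over an orthonormal basis (`Σ_e Q₂(e) = (n−1)|∇ζ|² − (n−3)ζ²·dens G` a.e., ✓`sum_q₂_eq` + tangency) and reads off the
`t²`-coefficient (`nonneg_of_expansion`: `0 ≤ tL + t²Q + |t|³M` for all small `t` forces `0 ≤ Q`); the normalisation `|ζ|, ‖∇ζ‖ ≤ 1`
is removed by homogeneity.
HONEST SCOPE.  One second-variation inequality for Sobolev maps; nothing of (RS) `MinimisingMapSmoothness`, (C), S1″, K1,
`MeanDeviationL`, `BlockLipschitzL`, `HistoryTailL` is proved here; YM₃ on T³ is rung R3, not Clay; YM gap NOT proved; no summit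
statement is proved here.

References: R. Schoen, K. Uhlenbeck, Regularity of minimizing harmonic maps into the sphere, Invent. Math. 78 (1984) 89–100
[SchoenUhlenbeck1984] (§1 (1.3)–(1.5)); L. Simon, Theorems on Regularity and Singularity of Energy Minimizing Maps (1996)
[Simon1996] (§2.2); F. Hélein, Harmonic Maps, Conservation Laws and Moving Frames (2002) [Helein2002].
-/

set_option autoImplicit false

noncomputable section

open MeasureTheory Set Function Filter Topology Metric TopologicalSpace
open scoped ContDiff RealInnerProductSpace BigOperators

namespace Summit.QuantumFields.YangMills.Theorems.PoincareLipschitzMinimiserStability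

open Literature.Analysis.FunctionSpaces (IsTestFunctionOn HasWeakFDerivOn)
open Summit.QuantumFields.YangMills.Theorems.PoincareLipschitzAxialStationarityLetters
open Summit.QuantumFields.YangMills.Theorems.PoincareLipschitzMinimiserStabilityLetters
open Summit.QuantumFields.YangMills.Theorems.PoincareLipschitzMinimiserSecondVariation
open Summit.QuantumFields.YangMills.Theorems.PoincareLipschitzMinimiserSecondVariationDirection

variable {F : Type*} [NormedAddCommGroup F] [InnerProductSpace ℝ F] [CompleteSpace F]

/-! ## §1 The sum over an orthonormal basis and the stability inequality -/

/-- **Elementary**: if `0 ≤ t·L + t²·Q + |t|³·M` for all `|t| ≤ t₀` (`t₀ > 0`, `M ≥ 0`), then `0 ≤ Q`. [folklore] -/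
theorem nonneg_of_expansion {L Q M t₀ : ℝ} (ht₀ : 0 < t₀) (hM : 0 ≤ M)
    (h : ∀ t : ℝ, |t| ≤ t₀ → 0 ≤ t * L + t ^ 2 * Q + |t| ^ 3 * M) : 0 ≤ Q := by
  by_contra hQ'
  have hQ : Q < 0 := not_le.mp hQ'
  -- symmetric difference kills `L`
  have hsym : ∀ t : ℝ, |t| ≤ t₀ → 0 ≤ t ^ 2 * Q + |t| ^ 3 * M := by
    intro t ht
    have h1 := h t ht
    have h2 := h (-t) (by rwa [abs_neg])
    rw [abs_neg] at h2
    nlinarith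
  set t : ℝ := min t₀ (-Q / (2 * (M + 1))) with htdef
  have htpos : 0 < t := lt_min ht₀ (div_pos (by linarith) (by linarith))
  have ht1 : t ≤ t₀ := min_le_left _ _
  have ht2 : t ≤ -Q / (2 * (M + 1)) := min_le_right _ _
  have h3 := hsym t (by rw [abs_of_pos htpos]; exact ht1)
  rw [abs_of_pos htpos] at h3
  have h4 : t * (2 * (M + 1)) ≤ -Q := (le_div_iff₀ (by linarith)).mp ht2
  have h5 : t ^ 2 * Q + t ^ 3 * M = t ^ 2 * (Q + t * M) := by ring
  rw [h5] at h3
  have h6 : 0 ≤ Q + t * M := by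
    by_contra h7
    have h7' : Q + t * M < 0 := not_le.mp h7
    have : t ^ 2 * (Q + t * M) < 0 := mul_neg_of_pos_of_neg (by positivity) h7'
    linarith
  nlinarith

/-- ★★★ **THE STABILITY INEQUALITY, normalised test function.**  Under the hypotheses of ✓`secondVariation_direction` (ball
minimiser, `|ζ| ≤ 1`, `‖∇ζ‖ ≤ 1`, `tsupport ζ ⊆ B_{ρ′}(y)`, `ρ′ < ρ`) and for any finite orthonormal basis `bON` of `F` (`n` vectors):
`(n − 3) · ∫_B ζ²·Σᵢ‖G eᵢ‖² ≤ (n − 1) · ∫_B Σᵢ(∂ᵢζ)²`. [cite: SchoenUhlenbeck1984, §1 (1.3)–(1.5)] -/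
theorem stability_normalised {Ω : Opens (EuclideanSpace ℝ (Fin 3))}
    {U : EuclideanSpace ℝ (Fin 3) → F} {G : EuclideanSpace ℝ (Fin 3) → EuclideanSpace ℝ (Fin 3) →L[ℝ] F}
    (hU : HasWeakFDerivOn Ω volume U G) (hU1 : ∀ x ∈ (Ω : Set (EuclideanSpace ℝ (Fin 3))), ‖U x‖ = 1)
    (hGi : IntegrableOn (fun x => ∑ i : Fin 3, ‖G x (EuclideanSpace.single i (1:ℝ))‖ ^ 2) (Ω : Set _) volume)
    {y : EuclideanSpace ℝ (Fin 3)} {ρ ρ' : ℝ} (hρ' : ρ' < ρ) (hB : ball y ρ ⊆ (Ω : Set _))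
    (hmin : ∀ (W : EuclideanSpace ℝ (Fin 3) → F) (GW : EuclideanSpace ℝ (Fin 3) → EuclideanSpace ℝ (Fin 3) →L[ℝ] F),
      HasWeakFDerivOn Ω volume W GW → (∀ x ∈ (Ω : Set (EuclideanSpace ℝ (Fin 3))), ‖W x‖ = 1) →
      IntegrableOn (fun x => ∑ i : Fin 3, ‖GW x (EuclideanSpace.single i (1:ℝ))‖ ^ 2) (Ω : Set _) volume →
      (∃ ρ'' : ℝ, ρ'' < ρ ∧ ∀ x, x ∉ ball y ρ'' → W x = U x) →
      ∫ x in ball y ρ, ∑ i : Fin 3, ‖G x (EuclideanSpace.single i (1:ℝ))‖ ^ 2 ≤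
        ∫ x in ball y ρ, ∑ i : Fin 3, ‖GW x (EuclideanSpace.single i (1:ℝ))‖ ^ 2)
    {ι : Type*} [Fintype ι] (bON : OrthonormalBasis ι ℝ F)
    {ζ : EuclideanSpace ℝ (Fin 3) → ℝ} (hζ : ContDiff ℝ ∞ ζ) (hζs : tsupport ζ ⊆ ball y ρ')
    (hζ1 : ∀ x, |ζ x| ≤ 1) (hζ'1 : ∀ x, ‖fderiv ℝ ζ x‖ ≤ 1) :
    ((Fintype.card ι : ℝ) - 3) * ∫ x in ball y ρ, ζ x ^ 2 * ∑ i : Fin 3, ‖G x (EuclideanSpace.single i (1:ℝ))‖ ^ 2 ≤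
      ((Fintype.card ι : ℝ) - 1) * ∫ x in ball y ρ, ∑ i : Fin 3, fderiv ℝ ζ x (EuclideanSpace.single i (1:ℝ)) ^ 2 := by
  obtain ⟨S, hS0, hS⟩ := density_le_expansion
  have hBm : MeasurableSet (ball y ρ) := measurableSet_ball
  have hζ'c : Continuous (fderiv ℝ ζ) := hζ.continuous_fderiv (by simp)
  -- opaque names for the per-direction integrals
  obtain ⟨Lf, hLf⟩ : ∃ Lf : ι → ℝ, ∀ k, Lf k = ∫ x in ball y ρ, ∑ i : Fin 3, 2 * (fderiv ℝ ζ x (EuclideanSpace.single i (1:ℝ)) *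
      ⟪G x (EuclideanSpace.single i (1:ℝ)), bON k⟫ - ζ x * ⟪U x, bON k⟫ * ‖G x (EuclideanSpace.single i (1:ℝ))‖ ^ 2) :=
    ⟨_, fun _ => rfl⟩
  obtain ⟨Qf, hQf⟩ : ∃ Qf : ι → ℝ, ∀ k, Qf k = ∫ x in ball y ρ, ∑ i : Fin 3,
      (fderiv ℝ ζ x (EuclideanSpace.single i (1:ℝ)) ^ 2 * (1 - ⟪U x, bON k⟫ ^ 2) -
      6 * ζ x * fderiv ℝ ζ x (EuclideanSpace.single i (1:ℝ)) * ⟪U x, bON k⟫ * ⟪G x (EuclideanSpace.single i (1:ℝ)), bON k⟫ -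
      ζ x ^ 2 * ‖G x (EuclideanSpace.single i (1:ℝ))‖ ^ 2 - ζ x ^ 2 * ⟪G x (EuclideanSpace.single i (1:ℝ)), bON k⟫ ^ 2 +
      4 * ζ x ^ 2 * ⟪U x, bON k⟫ ^ 2 * ‖G x (EuclideanSpace.single i (1:ℝ))‖ ^ 2) := ⟨_, fun _ => rfl⟩
  obtain ⟨M, hM⟩ : ∃ M : ℝ, M = ∫ x in ball y ρ, ((∑ i : Fin 3, ‖G x (EuclideanSpace.single i (1:ℝ))‖ ^ 2) +
      ∑ i : Fin 3, fderiv ℝ ζ x (EuclideanSpace.single i (1:ℝ)) ^ 2) := ⟨_, rfl⟩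
  have hdir : ∀ (k : ι) (t : ℝ), |t| ≤ 1 / 4 → 0 ≤ t * Lf k + t ^ 2 * Qf k + |t| ^ 3 * S * M := by
    intro k t ht
    rw [hLf, hQf, hM]
    exact secondVariation_direction hU hU1 hGi hρ' hB hmin (bON.orthonormal.1 k) hζ hζs hζ1 hζ'1 (S := S) hS ht
  have hsum : ∀ t : ℝ, |t| ≤ 1 / 4 → 0 ≤ t * (∑ k, Lf k) + t ^ 2 * (∑ k, Qf k) + |t| ^ 3 * ((Fintype.card ι : ℝ) * S * M) := by
    intro t ht
    have h := Finset.sum_nonneg fun k (_ : k ∈ (Finset.univ : Finset ι)) => hdir k t ht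
    have e1 : ∑ k, (t * Lf k + t ^ 2 * Qf k + |t| ^ 3 * S * M) =
        t * (∑ k, Lf k) + t ^ 2 * (∑ k, Qf k) + |t| ^ 3 * ((Fintype.card ι : ℝ) * S * M) := by
      rw [Finset.sum_add_distrib, Finset.sum_add_distrib, ← Finset.mul_sum, ← Finset.mul_sum, Finset.sum_const,
        Finset.card_univ, nsmul_eq_mul]
      ring
    linarith
  have hM0 : 0 ≤ (Fintype.card ι : ℝ) * S * M := by
    refine mul_nonneg (by positivity) ?_
    rw [hM]
    exact setIntegral_nonneg hBm fun x _ =>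
      add_nonneg (Finset.sum_nonneg fun i _ => sq_nonneg _) (Finset.sum_nonneg fun i _ => sq_nonneg _)
  have hQ0 := nonneg_of_expansion (by norm_num : (0:ℝ) < 1 / 4) hM0 hsum
  -- identify `Σ_k Qf k = (n−1)∫|∇ζ|² − (n−3)∫ζ²·dens`
  have hQint := fun k : ι => integrableOn_Q₂ hU hU1 hGi hB (bON.orthonormal.1 k) hζ hζ1 hζ'1
  have h1 : ∑ k, Qf k = ∫ x in ball y ρ, ∑ k, ∑ i : Fin 3,
      (fderiv ℝ ζ x (EuclideanSpace.single i (1:ℝ)) ^ 2 * (1 - ⟪U x, bON k⟫ ^ 2) -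
      6 * ζ x * fderiv ℝ ζ x (EuclideanSpace.single i (1:ℝ)) * ⟪U x, bON k⟫ * ⟪G x (EuclideanSpace.single i (1:ℝ)), bON k⟫ -
      ζ x ^ 2 * ‖G x (EuclideanSpace.single i (1:ℝ))‖ ^ 2 - ζ x ^ 2 * ⟪G x (EuclideanSpace.single i (1:ℝ)), bON k⟫ ^ 2 +
      4 * ζ x ^ 2 * ⟪U x, bON k⟫ ^ 2 * ‖G x (EuclideanSpace.single i (1:ℝ))‖ ^ 2) := by
    rw [integral_finsetSum _ fun k _ => hQint k]
    exact Finset.sum_congr rfl fun k _ => hQf k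
  -- the pointwise basis sum, a.e. on the ball
  have hae : ∀ᵐ x ∂(volume.restrict (ball y ρ)), (∑ k, ∑ i : Fin 3,
      (fderiv ℝ ζ x (EuclideanSpace.single i (1:ℝ)) ^ 2 * (1 - ⟪U x, bON k⟫ ^ 2) -
      6 * ζ x * fderiv ℝ ζ x (EuclideanSpace.single i (1:ℝ)) * ⟪U x, bON k⟫ * ⟪G x (EuclideanSpace.single i (1:ℝ)), bON k⟫ -
      ζ x ^ 2 * ‖G x (EuclideanSpace.single i (1:ℝ))‖ ^ 2 - ζ x ^ 2 * ⟪G x (EuclideanSpace.single i (1:ℝ)), bON k⟫ ^ 2 +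
      4 * ζ x ^ 2 * ⟪U x, bON k⟫ ^ 2 * ‖G x (EuclideanSpace.single i (1:ℝ))‖ ^ 2)) =
      ((Fintype.card ι : ℝ) - 1) * (∑ i : Fin 3, fderiv ℝ ζ x (EuclideanSpace.single i (1:ℝ)) ^ 2) -
      ((Fintype.card ι : ℝ) - 3) * (ζ x ^ 2 * ∑ i : Fin 3, ‖G x (EuclideanSpace.single i (1:ℝ))‖ ^ 2) := by
    filter_upwards [ae_restrict_of_ae_restrict_of_subset hB (inner_weakGrad_eq_zero_ae hU hU1), ae_restrict_mem hBm]
      with x hκ hxB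
    rw [Finset.sum_comm]
    rw [Finset.sum_congr rfl fun i _ => sum_q₂_eq bON (hU1 x (hB hxB)) (hκ (EuclideanSpace.single i (1:ℝ)))
      (fderiv ℝ ζ x (EuclideanSpace.single i (1:ℝ))) (ζ x)]
    rw [Finset.mul_sum, Finset.mul_sum, Finset.mul_sum, ← Finset.sum_sub_distrib]
    exact Finset.sum_congr rfl fun i _ => by ring
  -- integrability of the two limits
  have hζ'c : Continuous (fderiv ℝ ζ) := hζ.continuous_fderiv (by simp)
  have hgrad : IntegrableOn (fun x => ∑ i : Fin 3, fderiv ℝ ζ x (EuclideanSpace.single i (1:ℝ)) ^ 2) (ball y ρ) volume := by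
    have h := (integrableOn_R hGi hB hζ hζ'1).sub (hGi.mono_set hB)
    refine h.congr_fun (fun x _ => ?_) hBm
    simp only [Pi.sub_apply]
    ring
  have hzd : IntegrableOn (fun x => ζ x ^ 2 * ∑ i : Fin 3, ‖G x (EuclideanSpace.single i (1:ℝ))‖ ^ 2) (ball y ρ) volume := by
    refine integrableOn_ball_of_le hGi hB (((hζ.continuous.aestronglyMeasurable).pow 2).mul
      (hGi.mono_set hB).aestronglyMeasurable) 1 fun x _ => ?_
    have hz2 : ζ x ^ 2 ≤ 1 := by
      have := hζ1 x
      rw [← sq_abs]; nlinarith [abs_nonneg (ζ x)]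
    have hd : 0 ≤ ∑ i : Fin 3, ‖G x (EuclideanSpace.single i (1:ℝ))‖ ^ 2 := Finset.sum_nonneg fun i _ => sq_nonneg _
    rw [abs_of_nonneg (mul_nonneg (sq_nonneg _) hd)]
    nlinarith [sq_nonneg (ζ x)]
  have h2 : ∑ k, Qf k = ((Fintype.card ι : ℝ) - 1) * (∫ x in ball y ρ, ∑ i : Fin 3, fderiv ℝ ζ x (EuclideanSpace.single i (1:ℝ)) ^ 2) -
      ((Fintype.card ι : ℝ) - 3) * ∫ x in ball y ρ, ζ x ^ 2 * ∑ i : Fin 3, ‖G x (EuclideanSpace.single i (1:ℝ))‖ ^ 2 := by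
    rw [h1, integral_congr_ae hae, integral_sub (hgrad.const_mul _) (hzd.const_mul _), integral_const_mul, integral_const_mul]
  rw [h2] at hQ0
  linarith

/-! ## §2 General test functions, and the cube in the letters of the vended facts -/

/-- ★★★ **THE STABILITY INEQUALITY** [SchoenUhlenbeck1984, (1.3)–(1.5)]: for a ball minimiser `U` into the unit sphere of a real
Hilbert space with an orthonormal basis of `n` vectors, and every `ζ ∈ C^∞` with `tsupport ζ ⊆ B_{ρ′}(y)`, `ρ′ < ρ`:
`(n − 3)·∫_{B_ρ(y)} ζ²·Σᵢ‖G eᵢ‖² ≤ (n − 1)·∫_{B_ρ(y)} Σᵢ(∂ᵢζ)²` (the normalisation of ✓`stability_normalised` removed by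
homogeneity: apply it to `λζ`, `λ = (‖ζ‖_∞ + ‖∇ζ‖_∞ + 1)⁻¹`, and divide by `λ²`). [cite: SchoenUhlenbeck1984, §1 (1.3)–(1.5)] -/
theorem stability {Ω : Opens (EuclideanSpace ℝ (Fin 3))}
    {U : EuclideanSpace ℝ (Fin 3) → F} {G : EuclideanSpace ℝ (Fin 3) → EuclideanSpace ℝ (Fin 3) →L[ℝ] F}
    (hU : HasWeakFDerivOn Ω volume U G) (hU1 : ∀ x ∈ (Ω : Set (EuclideanSpace ℝ (Fin 3))), ‖U x‖ = 1)
    (hGi : IntegrableOn (fun x => ∑ i : Fin 3, ‖G x (EuclideanSpace.single i (1:ℝ))‖ ^ 2) (Ω : Set _) volume)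
    {y : EuclideanSpace ℝ (Fin 3)} {ρ ρ' : ℝ} (hρ' : ρ' < ρ) (hB : ball y ρ ⊆ (Ω : Set _))
    (hmin : ∀ (W : EuclideanSpace ℝ (Fin 3) → F) (GW : EuclideanSpace ℝ (Fin 3) → EuclideanSpace ℝ (Fin 3) →L[ℝ] F),
      HasWeakFDerivOn Ω volume W GW → (∀ x ∈ (Ω : Set (EuclideanSpace ℝ (Fin 3))), ‖W x‖ = 1) →
      IntegrableOn (fun x => ∑ i : Fin 3, ‖GW x (EuclideanSpace.single i (1:ℝ))‖ ^ 2) (Ω : Set _) volume →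
      (∃ ρ'' : ℝ, ρ'' < ρ ∧ ∀ x, x ∉ ball y ρ'' → W x = U x) →
      ∫ x in ball y ρ, ∑ i : Fin 3, ‖G x (EuclideanSpace.single i (1:ℝ))‖ ^ 2 ≤
        ∫ x in ball y ρ, ∑ i : Fin 3, ‖GW x (EuclideanSpace.single i (1:ℝ))‖ ^ 2)
    {ι : Type*} [Fintype ι] (bON : OrthonormalBasis ι ℝ F)
    {ζ : EuclideanSpace ℝ (Fin 3) → ℝ} (hζ : ContDiff ℝ ∞ ζ) (hζs : tsupport ζ ⊆ ball y ρ') :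
    ((Fintype.card ι : ℝ) - 3) * ∫ x in ball y ρ, ζ x ^ 2 * ∑ i : Fin 3, ‖G x (EuclideanSpace.single i (1:ℝ))‖ ^ 2 ≤
      ((Fintype.card ι : ℝ) - 1) * ∫ x in ball y ρ, ∑ i : Fin 3, fderiv ℝ ζ x (EuclideanSpace.single i (1:ℝ)) ^ 2 := by
  -- bounds on `ζ` and `∇ζ`
  have hζc : HasCompactSupport ζ :=
    IsCompact.of_isClosed_subset (isCompact_closedBall y ρ') (isClosed_tsupport ζ) (hζs.trans ball_subset_closedBall)
  have hζd : Differentiable ℝ ζ := hζ.differentiable (by simp)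
  have hζ'c : Continuous (fderiv ℝ ζ) := hζ.continuous_fderiv (by simp)
  obtain ⟨M₀, hM₀⟩ := hζc.exists_bound_of_continuous hζ.continuous
  obtain ⟨M₁, hM₁⟩ := (hζc.fderiv (𝕜 := ℝ)).exists_bound_of_continuous hζ'c
  have hM₀0 : 0 ≤ M₀ := (norm_nonneg _).trans (hM₀ y)
  have hM₁0 : 0 ≤ M₁ := (norm_nonneg _).trans (hM₁ y)
  set lam : ℝ := (M₀ + M₁ + 1)⁻¹ with hlam
  have hlam0 : 0 < lam := by rw [hlam]; positivity
  have hlam1 : lam * (M₀ + M₁ + 1) = 1 := by rw [hlam]; field_simp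
  -- the rescaled test function
  have hζ' : ContDiff ℝ ∞ (fun x => lam * ζ x) := contDiff_const.mul hζ
  have hζ's : tsupport (fun x => lam * ζ x) ⊆ ball y ρ' := by
    have : tsupport ((fun _ => lam) * ζ) ⊆ tsupport ζ := tsupport_mul_subset_right
    exact this.trans hζs
  have hfd : ∀ x, fderiv ℝ (fun x => lam * ζ x) x = lam • fderiv ℝ ζ x := fun x => fderiv_const_mul (hζd x) lam
  have hζ'1 : ∀ x, |lam * ζ x| ≤ 1 := by
    intro x
    rw [abs_mul, abs_of_pos hlam0]
    have h1 : |ζ x| ≤ M₀ := by have := hM₀ x; rwa [Real.norm_eq_abs] at this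
    nlinarith
  have hζ''1 : ∀ x, ‖fderiv ℝ (fun x => lam * ζ x) x‖ ≤ 1 := by
    intro x
    rw [hfd x, norm_smul, Real.norm_eq_abs, abs_of_pos hlam0]
    have h1 := hM₁ x
    nlinarith [norm_nonneg (fderiv ℝ ζ x)]
  have key := stability_normalised hU hU1 hGi hρ' hB hmin bON hζ' hζ's hζ'1 hζ''1
  -- undo the scaling
  have e1 : (fun x => (lam * ζ x) ^ 2 * ∑ i : Fin 3, ‖G x (EuclideanSpace.single i (1:ℝ))‖ ^ 2) =
      fun x => lam ^ 2 * (ζ x ^ 2 * ∑ i : Fin 3, ‖G x (EuclideanSpace.single i (1:ℝ))‖ ^ 2) := by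
    funext x; ring
  have e2 : (fun x => ∑ i : Fin 3, fderiv ℝ (fun x => lam * ζ x) x (EuclideanSpace.single i (1:ℝ)) ^ 2) =
      fun x => lam ^ 2 * ∑ i : Fin 3, fderiv ℝ ζ x (EuclideanSpace.single i (1:ℝ)) ^ 2 := by
    funext x
    rw [hfd x, Finset.mul_sum]
    exact Finset.sum_congr rfl fun i _ => by rw [smul_apply, smul_eq_mul]; ring
  rw [e1, e2, integral_const_mul, integral_const_mul] at key
  have hl2 : 0 < lam ^ 2 := by positivity
  nlinarith [key, hl2, mul_le_mul_of_nonneg_left key hl2.le]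

/-- ★★★ **THE STABILITY INEQUALITY ON THE UNIT CUBE, IN THE LETTERS OF THE VENDED FACTS** (`F = ℝ⁴`, `n = 4`): every `(U, G)`
satisfying the hypothesis block of lit `Literature.Analysis.PDE.MinimisingMapSmoothness` VERBATIM obeys, on every ball
`B̄_ρ(y) ⊆ Q` and for every `ζ ∈ C^∞` with `tsupport ζ ⊆ B_{ρ′}(y)`, `ρ′ < ρ`:
`∫_{B_ρ(y)} ζ²·Σᵢ‖G eᵢ‖² ≤ 3·∫_{B_ρ(y)} Σᵢ(∂ᵢζ)²` — [SchoenUhlenbeck1984, (1.5) with `k = 3`], the stability input of their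
Proposition 1.2 (tangent maps `ℝ³ → S³` are constant), i.e. of `d(3) = 3`. [cite: SchoenUhlenbeck1984, §1 (1.3)–(1.5) and Prop. 1.2] -/
theorem stability_of_cubeMinimiser
    (hQ : IsOpen {x : EuclideanSpace ℝ (Fin 3) | ∀ i : Fin 3, |x i| < 1})
    {U : EuclideanSpace ℝ (Fin 3) → EuclideanSpace ℝ (Fin 4)}
    {G : EuclideanSpace ℝ (Fin 3) → (EuclideanSpace ℝ (Fin 3) →L[ℝ] EuclideanSpace ℝ (Fin 4))}
    (hUG : HasWeakFDerivOn ⟨{x : EuclideanSpace ℝ (Fin 3) | ∀ i : Fin 3, |x i| < 1}, hQ⟩ volume U G ∧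
        (∀ x : EuclideanSpace ℝ (Fin 3), (∀ i : Fin 3, |x i| < 1) → ‖U x‖ = 1) ∧
        IntegrableOn (fun x => ∑ i : Fin 3, ‖G x (EuclideanSpace.single i (1:ℝ))‖ ^ 2) {x : EuclideanSpace ℝ (Fin 3) | ∀ i : Fin 3, |x i| < 1} ∧
        (∀ (y : EuclideanSpace ℝ (Fin 3)) (ρ : ℝ), 0 < ρ → closedBall y ρ ⊆ {x : EuclideanSpace ℝ (Fin 3) | ∀ i : Fin 3, |x i| < 1} →
          ∀ (W : EuclideanSpace ℝ (Fin 3) → EuclideanSpace ℝ (Fin 4)) (GW : EuclideanSpace ℝ (Fin 3) → (EuclideanSpace ℝ (Fin 3) →L[ℝ] EuclideanSpace ℝ (Fin 4))),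
          HasWeakFDerivOn ⟨{x : EuclideanSpace ℝ (Fin 3) | ∀ i : Fin 3, |x i| < 1}, hQ⟩ volume W GW →
          (∀ x : EuclideanSpace ℝ (Fin 3), (∀ i : Fin 3, |x i| < 1) → ‖W x‖ = 1) →
          IntegrableOn (fun x => ∑ i : Fin 3, ‖GW x (EuclideanSpace.single i (1:ℝ))‖ ^ 2) {x : EuclideanSpace ℝ (Fin 3) | ∀ i : Fin 3, |x i| < 1} →
          (∃ ρ' : ℝ, ρ' < ρ ∧ ∀ x : EuclideanSpace ℝ (Fin 3), x ∉ ball y ρ' → W x = U x) →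
          ∫ x in ball y ρ, ∑ i : Fin 3, ‖G x (EuclideanSpace.single i (1:ℝ))‖ ^ 2 ≤ ∫ x in ball y ρ, ∑ i : Fin 3, ‖GW x (EuclideanSpace.single i (1:ℝ))‖ ^ 2))
    {y : EuclideanSpace ℝ (Fin 3)} {ρ ρ' : ℝ} (hρ : 0 < ρ)
    (hyQ : closedBall y ρ ⊆ {x : EuclideanSpace ℝ (Fin 3) | ∀ i : Fin 3, |x i| < 1}) (hρ' : ρ' < ρ)
    {ζ : EuclideanSpace ℝ (Fin 3) → ℝ} (hζ : ContDiff ℝ ∞ ζ) (hζs : tsupport ζ ⊆ ball y ρ') :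
    ∫ x in ball y ρ, ζ x ^ 2 * ∑ i : Fin 3, ‖G x (EuclideanSpace.single i (1:ℝ))‖ ^ 2 ≤
      3 * ∫ x in ball y ρ, ∑ i : Fin 3, fderiv ℝ ζ x (EuclideanSpace.single i (1:ℝ)) ^ 2 := by
  obtain ⟨hU, hU1, hGi, hmin⟩ := hUG
  have key := stability (Ω := ⟨{x : EuclideanSpace ℝ (Fin 3) | ∀ i : Fin 3, |x i| < 1}, hQ⟩) hU
    (fun x hx => hU1 x hx) hGi hρ' (ball_subset_closedBall.trans hyQ)
    (fun W GW hW hW1 hWi hWU => hmin y ρ hρ hyQ W GW hW (fun x hx => hW1 x hx) hWi hWU)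
    (EuclideanSpace.basisFun (Fin 4) ℝ) hζ hζs
  simp only [Fintype.card_fin] at key
  norm_num at key
  linarith

end Summit.QuantumFields.YangMills.Theorems.PoincareLipschitzMinimiserStability

end
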